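import Mathlib
import HarnessLib

/-!
# Route `GenusKolyvaginAtTwo`, crux L_T `PowDvdShaCardAtTwoRT` (stmt-BirchSwinnertonDyer-23242), LINE 18 stub 3a⁗ —
# the ℚ-SIDE BOTTOM RUNG for a witness of index `≥ 3`: one swap from the «`X = 2Z`» reciprocity, every arithmetic input displayed

Seat `bsd-line-gk2-p2` g16 (PROVER seat 2/3, cell `bsd-f1-sign2`), `--supports stmt-BirchSwinnertonDyer-23242` (helper). Pure
bookkeeping (Mathlib only); THEOREMS ONLY. BSD is not proved by this file; neither is the crux or the stub.

WHY (memo `Cruxes/PowDvdShaCardAtTwoRT/Lines/plus-descent-step-b-prop52.md`, Addendum 4; ledger `Lines/plus-descent-oracle-ledger.md` §D).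
The ladder of LINE 18 runs on DEEP Kolyvagin products; the crux's witness `hPn` (`P(n) ∉ 2E(K[n])`) may be shallow, so its primes are
swapped for deep ones one at a time, keeping `2`-primitivity (the bottom rung, `M_r = 0`). Over `K` at level `2` the reciprocity step
is void for `τ`-fixed classes (`inv_λ ∘ res = 2·inv_ℓ`); over `ℚ` at level `2` it carries an uncontrolled bit at every `p ∣ d_K`
with `E(ℚ_p)[2] ≠ 0`. If the witness's primes have index `≥ L` with `L ≥ 3`, the ℚ-side argument closes for EVERY `K`:
take `Z_ℓ := desc_ε c_L(n·ℓ) ∈ H¹(ℚ, W^ε[2^L])` and an auxiliary `ỹ ∈ H¹(ℚ, W^ε[2^L])` chosen OVER `ℚ` (free at `ℓ₀`, transverse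
lines at the other primes of `n`, STRICT Kummer everywhere else — in particular at the primes of `d_K` and at `2`), of order EXACTLY
`4`; pair `X := 2·Z_ℓ` with `ỹ`: at every place where `Z_ℓ` is only RELAXED (it descends from `K`), `2·Z_ℓ` is strict
(`…RTRelaxedDoubling.two_zsmul_mem_selmerLocalKer_of_mem`) hence orthogonal to the Kummer class `ỹ`; at the own primes both lie in
the isotropic transverse line; at the new prime `ℓ` the FULL-ORDER prescriptions `(2^L, 4)` for `(c_L(n), ỹ)`
(`…RTFullOrderPairChebotarev`) make the term `2·(value of order 4) = ½`; so the `ℓ₀`-term is `½`, and since `ord ỹ_{ℓ₀} ≤ 4` the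
cyclic duality at `ℓ₀` forces `ord (Z_ℓ)_{ℓ₀} = 2^L`, i.e. `P(nℓ/ℓ₀) ∉ 2E(K_{λ₀})`: the product `nℓ/ℓ₀` is again `2`-primitive, with
one shallow prime fewer. This file is exactly that deduction over abstract local data; each hypothesis is a named tree theorem or an
owned input (see the docstring of `exists_deep_primitive_swap_rat`). Fed to `bottomOracle_of_primitive`-style packaging and the loop with
`C = ⊥` (`exists_good_not_mem_of_weakSwapOracle`), it raises an index-`≥ 3` witness to any depth.

References: [McCallumLMS1991] §5 Prop. 5.2 (proof, (10)–(13)), Prop. 4.4, Lemma 4.3, §2 Prop. 2.2; [Kolyvagin1991MathAnn] Thm. 2.1;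
[Matsuno2009] §3 (W_{v,K}).
-/

set_option autoImplicit false
-- `Summit.<P>.<Sub>` repeats `BirchSwinnertonDyer` by the tree's layout convention (D-0017)
set_option linter.dupNamespace false

namespace Summit.BirchSwinnertonDyer.BirchSwinnertonDyer.Theorems.GenusExact.PlusDescent

open Finset

section BottomRungRat

variable {U R Pl : Type*} [AddCommGroup U] [AddCommGroup R]

/-- **The ℚ-side bottom-rung swap for an index-`≥ 3` witness** (memo Addendum 4, «`X = 2Z`»). Abstract data: the level-`2^L` group
`U` (`= H¹(ℚ, W^ε[2^L])`) carrying the descended classes `Z ℓ = desc c_L(∏S·ℓ)` and the auxiliary class `y`; places `pl : ℕ → Pl`; local pairings `π v`; at each place the RELAXED condition `Rel v`, the STRICT (Kummer)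
condition `Kum v` and the TRANSVERSE line `Tr v`; predicates `Deep` (index `≥ L`), `FullZ ℓ` / `FullY ℓ` (full local order of
`c_L(∏S)` / of `y` at `ℓ`) and the target `Prim ℓ` («`P(∏(S∖ℓ₀)·ℓ) ∉ 2E(K_{λ₀})`»; `ℓ₀ ∈ S` the prime being swapped out). Hypotheses —
each a tree theorem or an owned input: `hZrel`/`hZtr` (Lemma 4.3 + descent: `Z ℓ` relaxed off the primes of `S` and `ℓ`; Prop. 4.4 value form: transverse at the own
primes — gk2-p3); `hy` (the auxiliary class over `ℚ`: strict Kummer off the places of `S`, transverse at `S ∖ ℓ₀` — existence = PT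
Lagrangian image at `ℓ₀`, gk2-p4/gk2-p3); `hKR` (**`π v (2·a) b = 0` for `a` relaxed, `b` Kummer**: `…RTRelaxedDoubling` + isotropy of
the Kummer condition); `hTr` (isotropy of the transverse line, I7 — gk2-p3); `hrec` (reciprocity over `ℚ`, two-exception form);
`hceb` (`…RTFullOrderPairChebotarev`: a deep `ℓ ∉ S` beyond any bound with `FullZ ℓ ∧ FullY ℓ`); `hfull` (Prop. 4.4 at `ℓ` + cyclic
duality with `ord y = 4`: full orders ⟹ `π (pl ℓ) (2·Z ℓ) y ≠ 0`); `hℓ₀` (cyclic duality at `ℓ₀` with `ord y_{ℓ₀} ≤ 4`, then Prop. 4.4: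
a non-zero `ℓ₀`-term forces `Prim ℓ`). Conclusion: deep primes `ℓ ∉ S` beyond any bound with `Prim ℓ`.
[cite: McCallumLMS1991, §5 Prop. 5.2 (proof, (10)–(13))] [cite: Kolyvagin1991MathAnn, Thm. 2.1] -/
theorem exists_deep_primitive_swap_rat
    (Deep FullZ FullY Prim : ℕ → Prop) (pl : ℕ → Pl)
    (Rel Kum Tr : Pl → AddSubgroup U) (π : Pl → U →+ U →+ R)
    (Z : ℕ → U) (y : U) (S : Finset ℕ) (ℓ₀ : ℕ)
    (hZrel : ∀ ℓ, Deep ℓ → ℓ ∉ S → ∀ v, (∀ l ∈ S, v ≠ pl l) → v ≠ pl ℓ → Z ℓ ∈ Rel v)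
    (hZtr : ∀ ℓ, Deep ℓ → ℓ ∉ S → ∀ l ∈ S, Z ℓ ∈ Tr (pl l))
    (hy : (∀ v, (∀ l ∈ S, v ≠ pl l) → y ∈ Kum v) ∧ ∀ l ∈ S, l ≠ ℓ₀ → y ∈ Tr (pl l))
    (hKR : ∀ v (a b : U), a ∈ Rel v → b ∈ Kum v → π v (2 • a) b = 0)
    (hTr : ∀ v (a b : U), a ∈ Tr v → b ∈ Tr v → π v a b = 0)
    (hrec : ∀ ℓ, Deep ℓ → ℓ ∉ S → ∀ a b : U, (∀ v, v ≠ pl ℓ₀ → v ≠ pl ℓ → π v a b = 0) →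
      π (pl ℓ₀) a b + π (pl ℓ) a b = 0)
    (hceb : ∀ b : ℕ, ∃ ℓ, b < ℓ ∧ Deep ℓ ∧ ℓ ∉ S ∧ FullZ ℓ ∧ FullY ℓ)
    (hfull : ∀ ℓ, Deep ℓ → ℓ ∉ S → FullZ ℓ → FullY ℓ → π (pl ℓ) (2 • Z ℓ) y ≠ 0)
    (hℓ₀ : ∀ ℓ, Deep ℓ → ℓ ∉ S → π (pl ℓ₀) (2 • Z ℓ) y ≠ 0 → Prim ℓ)
    (b : ℕ) :
    ∃ ℓ, b < ℓ ∧ Deep ℓ ∧ ℓ ∉ S ∧ Prim ℓ := by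
  obtain ⟨ℓ, hbℓ, hℓ, hℓS, hFZ, hFY⟩ := hceb b
  refine ⟨ℓ, hbℓ, hℓ, hℓS, hℓ₀ ℓ hℓ hℓS ?_⟩
  -- the reciprocity law for `(2·Z ℓ, y)`: every term off `{ℓ₀, ℓ}` vanishes
  have hsum := hrec ℓ hℓ hℓS (2 • Z ℓ) y (fun v hv₀ hvℓ ↦ by
    by_cases hS : ∀ l ∈ S, v ≠ pl l
    · -- off the places of `S` and `ℓ`: `Z ℓ` relaxed, `y` strict
      exact hKR v _ _ (hZrel ℓ hℓ hℓS v hS hvℓ) (hy.1 v hS)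
    · -- at an own prime `l ∈ S ∖ ℓ₀`: both transverse
      push Not at hS
      obtain ⟨l, hlS, rfl⟩ := hS
      have hl0 : l ≠ ℓ₀ := fun h ↦ hv₀ (by rw [h])
      exact hTr _ _ _ ((Tr (pl l)).nsmul_mem (hZtr ℓ hℓ hℓS l hlS) 2) (hy.2 l hlS hl0))
  -- the `ℓ`-term is non-zero (full orders), hence so is the `ℓ₀`-term
  intro h0
  exact hfull ℓ hℓ hℓS hFZ hFY (by rwa [h0, zero_add] at hsum)

/-- **The loop form**: with the invariant «`#S = r`, all primes Kolyvagin, `∏S` is `2`-primitive» and the swap of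
`exists_deep_primitive_swap_rat` available at every admissible `S` and `ℓ₀ ∈ S` (hypothesis `hstep`, its arithmetic supplied), every
admissible `S₀` is carried to an admissible set of DEEP primes — the weak loop `exists_good_not_mem_of_weakSwapOracle` needs no `C`
here, so this is a plain induction on the number of shallow primes. [cite: Kolyvagin1991MathAnn, Thm. 2.2 (proof: «replace
p′_1,…,p′_f by p_1,…,p_f»)] [cite: McCallumLMS1991, §5 Prop. 5.2] -/
theorem exists_deep_of_swap (Deep : ℕ → Prop) (Adm : Finset ℕ → Prop)
    (hstep : ∀ S, Adm S → ∀ ℓ₀ ∈ S, ¬ Deep ℓ₀ → ∃ ℓ, Deep ℓ ∧ ℓ ∉ S ∧ Adm (insert ℓ (S.erase ℓ₀)))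
    (S₀ : Finset ℕ) (hS₀ : Adm S₀) :
    ∃ S, Adm S ∧ S.card = S₀.card ∧ ∀ l ∈ S, Deep l := by
  classical
  -- induction on the number of shallow primes
  suffices key : ∀ (k : ℕ) (S : Finset ℕ), Adm S → (S.filter fun l ↦ ¬ Deep l).card ≤ k →
      ∃ S', Adm S' ∧ S'.card = S.card ∧ ∀ l ∈ S', Deep l from
    key _ S₀ hS₀ le_rfl
  intro k
  induction k with
  | zero =>
    intro S hS hk
    refine ⟨S, hS, rfl, fun l hl ↦ ?_⟩
    by_contra hnd
    have : l ∈ S.filter fun l ↦ ¬ Deep l := Finset.mem_filter.mpr ⟨hl, hnd⟩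
    rw [Nat.le_zero, Finset.card_eq_zero] at hk
    rw [hk] at this
    exact (Finset.notMem_empty l) this
  | succ k ih =>
    intro S hS hk
    by_cases hall : ∀ l ∈ S, Deep l
    · exact ⟨S, hS, rfl, hall⟩
    · push Not at hall
      obtain ⟨ℓ₀, hℓ₀S, hℓ₀⟩ := hall
      obtain ⟨ℓ, hℓ, hℓS, hAdm⟩ := hstep S hS ℓ₀ hℓ₀S hℓ₀
      have hcard : (insert ℓ (S.erase ℓ₀)).card = S.card := by
        rw [Finset.card_insert_of_notMem (fun h ↦ hℓS (Finset.mem_of_mem_erase h)), Finset.card_erase_of_mem hℓ₀S]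
        have : 0 < S.card := Finset.card_pos.mpr ⟨ℓ₀, hℓ₀S⟩
        omega
      have hbad : ((insert ℓ (S.erase ℓ₀)).filter fun l ↦ ¬ Deep l).card ≤ k := by
        rw [Finset.filter_insert, if_neg (not_not.mpr hℓ), Finset.filter_erase,
          Finset.card_erase_of_mem (Finset.mem_filter.mpr ⟨hℓ₀S, hℓ₀⟩)]
        omega
      obtain ⟨S', hS', hcard', hdeep⟩ := ih _ hAdm hbad
      exact ⟨S', hS', hcard'.trans hcard, hdeep⟩

end BottomRungRat

end Summit.BirchSwinnertonDyer.BirchSwinnertonDyer.Theorems.GenusExact.PlusDescent
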